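import Literature.Probability.RandomPlanarGeometry.SkorokhodSRWStrongApprox
import Literature.Probability.RandomPlanarGeometry.PlanarWienerRotation
import Literature.Probability.LatticeModels.SRWStepSequences
import HarnessLib

/-!
# The planar Skorokhod coupling of simple random walk and Brownian motion (rotation trick)

Topic `Literature/Probability/RandomPlanarGeometry`, sub-namespace `SkorokhodSRW`. Three plain
definitions (`dirOfSigns`, `planarSteps`, `planarBM`) and theorems; no named fact.

Brick B3e of Part B of the printed proof of `LSW2001_srw_nonIntersection_five_eighths`: the
planar case of Lawler, *Cut times for simple random walk*, EJP **1** (1996), paper 13, §3,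
**Lemma 3.1**: "Let `B` and `S` be defined as above. Then for every `ε > 0` there exist `δ > 0`
and `a < ∞` such that `P{sup_{0≤t≤n} |B(t) - S(td)| ≥ n^{1/4+ε}} ≤ a e^{-n^δ}`."

DEVIATION FROM THE PRINTED CONSTRUCTION (d = 2 only). Lawler couples `d` independent
one-dimensional Skorokhod embeddings through an independent multinomial clock `Z_n`. For `d = 2`
we use instead the classical rotation trick, which needs no auxiliary randomness: on the product
`C([0,∞), ℝ) × C([0,∞), ℝ)` of two independent Wiener paths `(p¹, p²)` with their embedded
simple random walks `Y¹, Y²` (`SkorokhodSRWEmbedding`), the lattice path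
`S_k = ((Y¹_k + Y²_k)/2, (Y¹_k - Y²_k)/2)` is EXACTLY a simple random walk on `ℤ²` (the map
`(ΔY¹, ΔY²) ∈ {±1}² ↦ ΔS ∈ {±e₁, ±e₂}` is a bijection, `dirOfSigns`), and
`W(t) = ((p¹(t) + p²(t))/2, (p¹(t) - p²(t))/2)` is a planar Brownian motion with covariance
`(t/2)·Id`, i.e. `t ↦ W(2t)` is a standard planar Brownian motion — Lawler's normalisation
`B(t) ≈ S(2t)`. That `t ↦ W(2t)` is again a pair of independent Wiener paths — rotation
invariance of the planar Wiener law — is `PlanarWienerRotation.map_rotate_eq_prod_wienerLawC`;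
it is restated here for `planarBM` (`map_planarBM_two_mul_eq_prod_wienerLawC`), so that the
coupling is between an exact planar simple random walk and a STANDARD planar Brownian motion
`B(t) = W(2t)`, compared at the times `t = k/2` (`measure_exists_le_norm_pos_sub_stdBM_le`).

* `measure_planarSteps_eq` — **`S` is a simple random walk**: every `n`-step pattern has
  probability `4^{-n}`; `measureReal_planarSteps_mem` — `P[S|ₙ ∈ E] = #E / 4^n`;
* `ae_realPos_planarSteps` — the positions of `S` are the rotated half-sums of the embedded
  walks;
* `measure_exists_le_norm_pos_sub_planarBM_le` — **Lemma 3.1 (d = 2, integer times, sup norm)**: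
  `∀ ε > 0 ∃ δ > 0 ∃ a, ∀ n ≥ 1, P[∃ k ≤ n, n^{1/4+ε} ≤ ‖S_k - W(k)‖_∞] ≤ a e^{-n^δ}`;
* `map_planarBM_two_mul_eq_prod_wienerLawC` — the coordinate paths of `B(t) = W(2t)` are a pair
  of independent Wiener paths (standard planar Brownian motion);
  `measure_exists_le_norm_pos_sub_stdBM_le` — Lemma 3.1 in Lawler's normalisation
  `P[∃ k ≤ n, n^{1/4+ε} ≤ ‖S_k - B(k/2)‖_∞] ≤ a e^{-n^δ}`.

## References

* G. F. Lawler, *Cut times for simple random walk*, Electron. J. Probab. **1** (1996), no. 13,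
  §3, Lemma 3.1. [Lawler1996CutTimes]
-/

noncomputable section

open MeasureTheory ProbabilityTheory Filter Set Real
open scoped NNReal ENNReal Topology

namespace Literature.Probability.RandomPlanarGeometry

namespace SkorokhodSRW

open Literature.Probability.LatticeModels Literature.Probability.LatticeModels.SRW

/-! ### The rotation dictionary between sign pairs and lattice directions -/

/-- **Rotation trick, one step**: the lattice direction of `ℤ²` encoded by a pair of signs
`(a, b) ∈ {±1}²` — `ΔS = ((a + b)/2, (a - b)/2)`: `(1,1) ↦ +e₀`, `(-1,-1) ↦ -e₀`, `(1,-1) ↦ +e₁`,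
`(-1,1) ↦ -e₁` (junk for other reals). [folklore] -/
def dirOfSigns (a b : ℝ) : Dir 2 :=
  if a = 1 then (if b = 1 then (0, true) else (1, true)) else (if b = 1 then (1, false) else (0, false))

/-- The sign pair of a lattice direction (inverse of `dirOfSigns` on `{±1}²`). [folklore] -/
theorem dirOfSigns_signs (v : Dir 2) :
    dirOfSigns (if v.2 then 1 else -1) (if v.2 = (decide (v.1 = 0)) then 1 else -1) = v := by
  obtain ⟨i, c⟩ := v
  fin_cases i <;> cases c <;> simp [dirOfSigns, (by norm_num : (-1 : ℝ) ≠ 1)]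

/-- `dirOfSigns` hits `v` exactly at the sign pair of `v` (for sign inputs). [folklore] -/
theorem dirOfSigns_eq_iff {a b : ℝ} (ha : a = 1 ∨ a = -1) (hb : b = 1 ∨ b = -1) (v : Dir 2) :
    dirOfSigns a b = v ↔
      a = (if v.2 then 1 else -1) ∧ b = (if v.2 = (decide (v.1 = 0)) then 1 else -1) := by
  obtain ⟨i, c⟩ := v
  fin_cases i <;> cases c <;> rcases ha with rfl | rfl <;> rcases hb with rfl | rfl <;>
    simp [dirOfSigns, (by norm_num : (-1 : ℝ) ≠ 1), (by norm_num : (1 : ℝ) ≠ -1)]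

/-- **The rotated step**: for signs `a, b`, the lattice vector of `dirOfSigns a b`, read in `ℝ²`,
is `((a + b)/2, (a - b)/2)`. [folklore] -/
theorem cast_stepVec_dirOfSigns {a b : ℝ} (ha : a = 1 ∨ a = -1) (hb : b = 1 ∨ b = -1) :
    (fun j ↦ ((stepVec (dirOfSigns a b) j : ℤ) : ℝ)) = ![(a + b) / 2, (a - b) / 2] := by
  funext j
  rcases ha with rfl | rfl <;> rcases hb with rfl | rfl <;> fin_cases j <;>
    simp [dirOfSigns, stepVec] <;> norm_num

/-! ### The planar walk and the planar Brownian motion of the coupling -/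

/-- **The planar walk of the coupling**: its `i`-th step is the rotated pair of the `i`-th steps
of the two embedded walks. [folklore] -/
def planarSteps (n : ℕ) (ω : C(ℝ≥0, ℝ) × C(ℝ≥0, ℝ)) : StepSeq 2 n :=
  fun i ↦ dirOfSigns (step i ω.1) (step i ω.2)

/-- **The planar Brownian motion of the coupling** (covariance `(t/2)·Id`):
`W(t) = ((p¹(t) + p²(t))/2, (p¹(t) - p²(t))/2)`. [folklore] -/
def planarBM (t : ℝ≥0) (ω : C(ℝ≥0, ℝ) × C(ℝ≥0, ℝ)) : Fin 2 → ℝ :=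
  ![(ω.1 t + ω.2 t) / 2, (ω.1 t - ω.2 t) / 2]

/-- Unfolding of the planar steps. [folklore] -/
theorem planarSteps_apply (n : ℕ) (ω : C(ℝ≥0, ℝ) × C(ℝ≥0, ℝ)) (i : Fin n) :
    planarSteps n ω i = dirOfSigns (step i ω.1) (step i ω.2) := rfl

/-- **Positions of the planar walk are the rotated half-sums of the embedded walks**: if all steps
of both coordinate paths are `±1`, then `S_k = ((Y¹_k + Y²_k)/2, (Y¹_k - Y²_k)/2)` for `k ≤ n`.
[folklore] -/
theorem cast_pos_planarSteps {ω : C(ℝ≥0, ℝ) × C(ℝ≥0, ℝ)}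
    (h1 : ∀ k, step k ω.1 = -1 ∨ step k ω.1 = 1) (h2 : ∀ k, step k ω.2 = -1 ∨ step k ω.2 = 1)
    {n k : ℕ} (hk : k ≤ n) :
    (fun j ↦ ((pos (planarSteps n ω) k j : ℤ) : ℝ)) =
      ![(walk k ω.1 + walk k ω.2) / 2, (walk k ω.1 - walk k ω.2) / 2] := by
  induction k with
  | zero =>
    funext j
    fin_cases j <;> simp
  | succ k ih =>
    have hk' : k < n := hk
    rw [pos_succ _ hk']
    have hstep := cast_stepVec_dirOfSigns ((h1 k).symm) ((h2 k).symm)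
    funext j
    have ihj := congrFun (ih hk'.le) j
    have hsj := congrFun hstep j
    simp only [Pi.add_apply, Int.cast_add, planarSteps_apply] at ihj hsj ⊢
    rw [ihj, hsj, walk_succ, walk_succ]
    fin_cases j <;> simp <;> ring

/-- **Coordinate reduction of the coupling error**: with `D¹ = Y¹_k - p¹(k)`, `D² = Y²_k - p²(k)`,
`‖S_k - W(k)‖_∞ ≤ max |D¹| |D²|` (each coordinate of `S_k - W(k)` is `(D¹ ± D²)/2`). [folklore] -/
theorem norm_rot_sub_le (y1 y2 q1 q2 : ℝ) :
    ‖(![(y1 + y2) / 2, (y1 - y2) / 2] - ![(q1 + q2) / 2, (q1 - q2) / 2] : Fin 2 → ℝ)‖ ≤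
      max |y1 - q1| |y2 - q2| := by
  refine (pi_norm_le_iff_of_nonneg (le_max_of_le_left (abs_nonneg _))).2 fun j ↦ ?_
  have hm1 : |y1 - q1| ≤ max |y1 - q1| |y2 - q2| := le_max_left _ _
  have hm2 : |y2 - q2| ≤ max |y1 - q1| |y2 - q2| := le_max_right _ _
  fin_cases j
  · simp only [Pi.sub_apply, Fin.zero_eta, Matrix.cons_val_zero, Real.norm_eq_abs]
    rw [show (y1 + y2) / 2 - (q1 + q2) / 2 = ((y1 - q1) + (y2 - q2)) / 2 by ring, abs_div,
      abs_two]
    linarith [abs_add_le (y1 - q1) (y2 - q2)]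
  · simp only [Pi.sub_apply, Fin.mk_one, Matrix.cons_val_one, Matrix.cons_val_zero,
      Real.norm_eq_abs]
    rw [show (y1 - y2) / 2 - (q1 - q2) / 2 = ((y1 - q1) - (y2 - q2)) / 2 by ring, abs_div,
      abs_two]
    linarith [abs_sub (y1 - q1) (y2 - q2)]

section Law

variable [MeasurableSpace C(ℝ≥0, ℝ)] [BorelSpace C(ℝ≥0, ℝ)]

/-- The planar step map is measurable (piecewise constant on measurable pieces). [folklore] -/
theorem measurable_planarSteps (n : ℕ) : Measurable (planarSteps n) := by
  refine measurable_pi_lambda _ fun i ↦ ?_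
  have hA : MeasurableSet {ω : C(ℝ≥0, ℝ) × C(ℝ≥0, ℝ) | step i ω.1 = 1} :=
    (measurable_step i).comp measurable_fst (measurableSet_singleton 1)
  have hB : MeasurableSet {ω : C(ℝ≥0, ℝ) × C(ℝ≥0, ℝ) | step i ω.2 = 1} :=
    (measurable_step i).comp measurable_snd (measurableSet_singleton 1)
  change Measurable fun ω : C(ℝ≥0, ℝ) × C(ℝ≥0, ℝ) ↦ dirOfSigns (step i ω.1) (step i ω.2)
  unfold dirOfSigns
  exact Measurable.ite hA (Measurable.ite hB measurable_const measurable_const)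
    (Measurable.ite hB measurable_const measurable_const)

/-- The planar Brownian motion has measurable marginals. [folklore] -/
theorem measurable_planarBM (t : ℝ≥0) : Measurable (planarBM t) := by
  refine measurable_pi_lambda _ fun j ↦ ?_
  have h1 : Measurable fun ω : C(ℝ≥0, ℝ) × C(ℝ≥0, ℝ) ↦ ω.1 t :=
    (measurable_coordProcess t).comp measurable_fst
  have h2 : Measurable fun ω : C(ℝ≥0, ℝ) × C(ℝ≥0, ℝ) ↦ ω.2 t :=
    (measurable_coordProcess t).comp measurable_snd
  fin_cases j
  · exact (h1.add h2).div_const 2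
  · exact (h1.sub h2).div_const 2

/-- Almost surely (product Wiener law) all steps of both coordinate paths are `±1` and both
embedding identities hold. [folklore] -/
theorem ae_prod_steps :
    ∀ᵐ ω ∂(wienerLawC.prod wienerLawC : Measure (C(ℝ≥0, ℝ) × C(ℝ≥0, ℝ))),
      (∀ k, step k ω.1 = -1 ∨ step k ω.1 = 1) ∧ (∀ k, step k ω.2 = -1 ∨ step k ω.2 = 1) ∧
      (∀ k, ω.1 (embTime k ω.1) = walk k ω.1) ∧ (∀ k, ω.2 (embTime k ω.2) = walk k ω.2) := by
  have hf := (measurePreserving_fst (μ := wienerLawC) (ν := wienerLawC)).quasiMeasurePreserving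
  have hs := (measurePreserving_snd (μ := wienerLawC) (ν := wienerLawC)).quasiMeasurePreserving
  filter_upwards [hf.ae ae_exit_ne_top_and_step, hs.ae ae_exit_ne_top_and_step,
    hf.ae ae_apply_embTime_eq_walk, hs.ae ae_apply_embTime_eq_walk] with ω h1 h2 h3 h4
  exact ⟨fun k ↦ (h1 k).2, fun k ↦ (h2 k).2, h3, h4⟩

/-! ### The planar walk is a simple random walk -/

/-- **`S` is a simple random walk on `ℤ²`**: every `n`-step pattern `σ` has probability `4^{-n}`
under the product Wiener law — the two sign patterns of `σ` are independent events of
probability `2^{-n}` each (`measure_steps_eq`). Lawler (1996), §3 ("`S` is a `d`-dimensional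
simple random walk"). [cite: Lawler1996CutTimes, §3] -/
theorem measureReal_planarSteps_eq (n : ℕ) (σ : StepSeq 2 n) :
    (wienerLawC.prod wienerLawC : Measure (C(ℝ≥0, ℝ) × C(ℝ≥0, ℝ))).real
      {ω | planarSteps n ω = σ} = (1 / 4) ^ n := by
  -- the two sign patterns of `σ`
  set s1 : ℕ → ℝ := fun i ↦ if h : i < n then (if (σ ⟨i, h⟩).2 then 1 else -1) else 1 with hs1
  set s2 : ℕ → ℝ := fun i ↦ if h : i < n then
    (if (σ ⟨i, h⟩).2 = (decide ((σ ⟨i, h⟩).1 = 0)) then 1 else -1) else 1 with hs2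
  have hs1' : ∀ i < n, s1 i = 1 ∨ s1 i = -1 := by
    intro i hi; simp only [hs1, dif_pos hi]; split_ifs <;> simp
  have hs2' : ∀ i < n, s2 i = 1 ∨ s2 i = -1 := by
    intro i hi; simp only [hs2, dif_pos hi]; split_ifs <;> simp
  set A := {p : C(ℝ≥0, ℝ) | ∀ i < n, step i p = s1 i} with hA
  set B := {p : C(ℝ≥0, ℝ) | ∀ i < n, step i p = s2 i} with hB
  -- a.e. the pattern event is the product event
  have hae : {ω : C(ℝ≥0, ℝ) × C(ℝ≥0, ℝ) | planarSteps n ω = σ} =ᵐ[wienerLawC.prod wienerLawC]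
      (A ×ˢ B : Set (C(ℝ≥0, ℝ) × C(ℝ≥0, ℝ))) := by
    filter_upwards [ae_prod_steps] with ω hω
    obtain ⟨h1, h2, -, -⟩ := hω
    simp only [eq_iff_iff, hA, hB]
    constructor
    · intro h
      refine ⟨fun i hi ↦ ?_, fun i hi ↦ ?_⟩
      · have := congrFun h ⟨i, hi⟩
        rw [planarSteps_apply, dirOfSigns_eq_iff (h1 i).symm (h2 i).symm] at this
        rw [this.1, hs1]
        simp [hi]
      · have := congrFun h ⟨i, hi⟩
        rw [planarSteps_apply, dirOfSigns_eq_iff (h1 i).symm (h2 i).symm] at this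
        rw [this.2, hs2]
        simp [hi]
    · rintro ⟨hA', hB'⟩
      funext i
      rw [planarSteps_apply, dirOfSigns_eq_iff (h1 i).symm (h2 i).symm, hA' i i.2, hB' i i.2,
        hs1, hs2]
      simp [i.2]
  rw [measureReal_congr hae, measureReal_prod_prod, measureReal_steps_eq n s1 hs1',
    measureReal_steps_eq n s2 hs2', ← mul_pow]
  norm_num

/-- The pattern events are measurable. [folklore] -/
theorem measurableSet_planarSteps_eq (n : ℕ) (σ : StepSeq 2 n) :
    MeasurableSet {ω : C(ℝ≥0, ℝ) × C(ℝ≥0, ℝ) | planarSteps n ω = σ} :=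
  measurable_planarSteps n (measurableSet_singleton σ)

/-- **`S` is a simple random walk on `ℤ²`, `ℝ≥0∞` form**: `P[S|ₙ = σ] = 4⁻¹ ^ n`.
[cite: Lawler1996CutTimes, §3] -/
theorem measure_planarSteps_eq (n : ℕ) (σ : StepSeq 2 n) :
    (wienerLawC.prod wienerLawC : Measure (C(ℝ≥0, ℝ) × C(ℝ≥0, ℝ))) {ω | planarSteps n ω = σ} =
      4⁻¹ ^ n := by
  have h := measureReal_planarSteps_eq n σ
  rw [measureReal_def] at h
  have h' := congrArg ENNReal.ofReal h
  rw [ENNReal.ofReal_toReal (measure_ne_top _ _)] at h'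
  rw [h', ENNReal.ofReal_pow (by norm_num), one_div, ENNReal.ofReal_inv_of_pos (by norm_num),
    ENNReal.ofReal_ofNat]

/-- **The law of the first `n` steps is uniform**: `P[S|ₙ ∈ E] = #E / 4^n` for every set `E` of
`n`-step patterns (so every simple-random-walk probability is the corresponding path count over
`4^n`, the normalisation of `PlaneNonIntersection.nonIntersectingPairs`). [cite: Lawler1996CutTimes, §3] -/
theorem measureReal_planarSteps_mem (n : ℕ) (E : Finset (StepSeq 2 n)) :
    (wienerLawC.prod wienerLawC : Measure (C(ℝ≥0, ℝ) × C(ℝ≥0, ℝ))).real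
      {ω | planarSteps n ω ∈ E} = (E.card : ℝ) / 4 ^ n := by
  have hset : {ω : C(ℝ≥0, ℝ) × C(ℝ≥0, ℝ) | planarSteps n ω ∈ E} =
      ⋃ σ ∈ E, {ω | planarSteps n ω = σ} := by
    ext ω
    simp
  rw [hset, measureReal_biUnion_finset]
  · rw [Finset.sum_congr rfl fun σ _ ↦ measureReal_planarSteps_eq n σ, Finset.sum_const,
      nsmul_eq_mul, one_div, inv_pow, div_eq_mul_inv]
  · intro σ _ τ _ hστ
    exact Set.disjoint_left.2 fun ω h1 h2 ↦ hστ (h1.symm.trans h2)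
  · exact fun σ _ ↦ measurableSet_planarSteps_eq n σ

/-! ### The positions and the coupling bound -/

/-- **Almost surely `S_k = ((Y¹_k + Y²_k)/2, (Y¹_k - Y²_k)/2)`** for all `k ≤ n`. [folklore] -/
theorem ae_cast_pos_planarSteps :
    ∀ᵐ ω ∂(wienerLawC.prod wienerLawC : Measure (C(ℝ≥0, ℝ) × C(ℝ≥0, ℝ))),
      ∀ n k, k ≤ n → (fun j ↦ ((pos (planarSteps n ω) k j : ℤ) : ℝ)) =
        ![(walk k ω.1 + walk k ω.2) / 2, (walk k ω.1 - walk k ω.2) / 2] := by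
  filter_upwards [ae_prod_steps] with ω hω n k hk
  exact cast_pos_planarSteps hω.1 hω.2.1 hk

/-- **Lemma 3.1 of Lawler (1996), planar case, integer times, sup norm.** For every `ε > 0`
there are `δ > 0` and `a < ∞` such that for all `n ≥ 1`,
`P[∃ k ≤ n, n^{1/4+ε} ≤ ‖S_k - W(k)‖_∞] ≤ a e^{-n^δ}`, where `S` is the planar simple random
walk and `W` the planar Brownian motion (covariance `(t/2)·Id`, `W(2t)` standard) of the rotation
coupling. [cite: Lawler1996CutTimes, Lemma 3.1] -/
theorem measure_exists_le_norm_pos_sub_planarBM_le {e : ℝ} (he : 0 < e) :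
    ∃ δ : ℝ, 0 < δ ∧ ∃ a : ℝ, 0 < a ∧ ∀ n : ℕ, 1 ≤ n →
      (wienerLawC.prod wienerLawC : Measure (C(ℝ≥0, ℝ) × C(ℝ≥0, ℝ)))
        {ω | ∃ k ≤ n, (n : ℝ) ^ (1 / 4 + e) ≤
          ‖(fun j ↦ ((pos (planarSteps n ω) k j : ℤ) : ℝ)) - planarBM k ω‖} ≤
        ENNReal.ofReal (a * exp (-(n : ℝ) ^ δ)) := by
  obtain ⟨δ, hδ, a, ha, h1D⟩ := wienerLawC_exists_le_abs_walk_sub_le (e := e) he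
  refine ⟨δ, hδ, 2 * a, by positivity, fun n hn ↦ ?_⟩
  set x : ℝ := (n : ℝ) ^ (1 / 4 + e) with hx
  set μ₂ := (wienerLawC.prod wienerLawC : Measure (C(ℝ≥0, ℝ) × C(ℝ≥0, ℝ))) with hμ₂
  set F := {p : C(ℝ≥0, ℝ) | ∃ k ≤ n, x ≤ |walk k p - p k|} with hF
  set G := {ω : C(ℝ≥0, ℝ) × C(ℝ≥0, ℝ) | ∀ n k, k ≤ n →
    (fun j ↦ ((pos (planarSteps n ω) k j : ℤ) : ℝ)) =
      ![(walk k ω.1 + walk k ω.2) / 2, (walk k ω.1 - walk k ω.2) / 2]} with hG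
  have hGnull : μ₂ Gᶜ = 0 := by
    have h0 := (ae_cast_pos_planarSteps :
      ∀ᵐ ω ∂μ₂, ∀ n k, k ≤ n → (fun j ↦ ((pos (planarSteps n ω) k j : ℤ) : ℝ)) =
        ![(walk k ω.1 + walk k ω.2) / 2, (walk k ω.1 - walk k ω.2) / 2])
    rw [ae_iff] at h0
    simpa [hG, compl_setOf] using h0
  have hcover : {ω : C(ℝ≥0, ℝ) × C(ℝ≥0, ℝ) | ∃ k ≤ n, x ≤
      ‖(fun j ↦ ((pos (planarSteps n ω) k j : ℤ) : ℝ)) - planarBM k ω‖} ⊆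
      ((F ×ˢ univ) ∪ (univ ×ˢ F)) ∪ Gᶜ := by
    intro ω hω
    by_cases hωG : ω ∈ G
    · left
      obtain ⟨k, hk, hxk⟩ := hω
      rw [hωG n k hk] at hxk
      have hle := hxk.trans (norm_rot_sub_le (walk k ω.1) (walk k ω.2) (ω.1 k) (ω.2 k))
      rcases le_max_iff.1 hle with h | h
      · exact Or.inl ⟨⟨k, hk, h⟩, mem_univ _⟩
      · exact Or.inr ⟨mem_univ _, ⟨k, hk, h⟩⟩
    · exact Or.inr hωG
  have hFb := h1D n hn
  calc μ₂ {ω | ∃ k ≤ n, x ≤ ‖(fun j ↦ ((pos (planarSteps n ω) k j : ℤ) : ℝ)) - planarBM k ω‖}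
      ≤ μ₂ (((F ×ˢ univ) ∪ (univ ×ˢ F)) ∪ Gᶜ) := measure_mono hcover
    _ ≤ μ₂ (F ×ˢ univ) + μ₂ (univ ×ˢ F) + 0 := by
        rw [← hGnull]
        exact (measure_union_le _ _).trans (add_le_add (measure_union_le _ _) le_rfl)
    _ = wienerLawC F + wienerLawC F := by
        rw [add_zero, hμ₂, Measure.prod_prod, Measure.prod_prod, measure_univ, mul_one, one_mul]
    _ ≤ ENNReal.ofReal (a * exp (-(n : ℝ) ^ δ)) + ENNReal.ofReal (a * exp (-(n : ℝ) ^ δ)) :=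
        add_le_add hFb hFb
    _ = ENNReal.ofReal (2 * a * exp (-(n : ℝ) ^ δ)) := by
        rw [← ENNReal.ofReal_add (by positivity) (by positivity)]
        congr 1
        ring

/-! ### Lawler's normalisation: a standard planar Brownian motion `B(t) = W(2t)` -/

omit [MeasurableSpace C(ℝ≥0, ℝ)] [BorelSpace C(ℝ≥0, ℝ)] in
/-- `W(2t) = (U(t), V(t))` coordinatewise (definitional). [folklore] -/
theorem planarBM_two_mul_apply (t : ℝ≥0) (ω : C(ℝ≥0, ℝ) × C(ℝ≥0, ℝ)) :
    planarBM (2 * t) ω 0 = (ω.1 (2 * t) + ω.2 (2 * t)) / 2 ∧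
      planarBM (2 * t) ω 1 = (ω.1 (2 * t) - ω.2 (2 * t)) / 2 := ⟨rfl, rfl⟩

omit [MeasurableSpace C(ℝ≥0, ℝ)] [BorelSpace C(ℝ≥0, ℝ)] in
/-- `B(k/2) = W(k)` at the comparison times. [folklore] -/
theorem planarBM_two_mul_half (k : ℕ) (ω : C(ℝ≥0, ℝ) × C(ℝ≥0, ℝ)) :
    planarBM (2 * ((k : ℝ≥0) / 2)) ω = planarBM k ω := by
  rw [mul_div_cancel₀ (k : ℝ≥0) two_ne_zero]

/-- **`B(t) = W(2t)` is a standard planar Brownian motion**: its two coordinate paths are a pair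
of independent Wiener paths under the product Wiener law (`PlanarWienerRotation`).
[cite: Legall2016, Exercise 2.26] -/
theorem map_planarBM_two_mul_eq_prod_wienerLawC :
    (wienerLawC.prod wienerLawC).map (fun ω : C(ℝ≥0, ℝ) × C(ℝ≥0, ℝ) ↦
      (toPathC (fun t (ω : C(ℝ≥0, ℝ) × C(ℝ≥0, ℝ)) ↦ planarBM (2 * t) ω 0) continuous_rotU ω,
       toPathC (fun t (ω : C(ℝ≥0, ℝ) × C(ℝ≥0, ℝ)) ↦ planarBM (2 * t) ω 1) continuous_rotV ω)) =
      wienerLawC.prod wienerLawC :=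
  map_rotate_eq_prod_wienerLawC

/-- **Lemma 3.1 of Lawler (1996), d = 2, in Lawler's normalisation**: with the standard planar
Brownian motion `B(t) = W(2t)` and the planar simple random walk `S` of the rotation coupling,
for every `ε > 0` there are `δ > 0` and `a < ∞` with
`P[∃ k ≤ n, n^{1/4+ε} ≤ ‖S_k - B(k/2)‖_∞] ≤ a e^{-n^δ}` for all `n ≥ 1` (the printed statement
compares `B(t)` with `S(2t)`, `t ≤ n`; here at the lattice times `t = k/2`).
[cite: Lawler1996CutTimes, Lemma 3.1] -/
theorem measure_exists_le_norm_pos_sub_stdBM_le {e : ℝ} (he : 0 < e) :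
    ∃ δ : ℝ, 0 < δ ∧ ∃ a : ℝ, 0 < a ∧ ∀ n : ℕ, 1 ≤ n →
      (wienerLawC.prod wienerLawC : Measure (C(ℝ≥0, ℝ) × C(ℝ≥0, ℝ)))
        {ω | ∃ k ≤ n, (n : ℝ) ^ (1 / 4 + e) ≤
          ‖(fun j ↦ ((pos (planarSteps n ω) k j : ℤ) : ℝ)) - planarBM (2 * ((k : ℝ≥0) / 2)) ω‖} ≤
        ENNReal.ofReal (a * exp (-(n : ℝ) ^ δ)) := by
  simp only [planarBM_two_mul_half]
  exact measure_exists_le_norm_pos_sub_planarBM_le he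

end Law

end SkorokhodSRW

end Literature.Probability.RandomPlanarGeometry
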